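import Summits.QuantumFields.YangMills.Theorems.ConvexGribovBodyCovarianceBoundDefs
import Summits.QuantumFields.YangMills.Theorems.ConvexGribovBodyCovarianceBoundDefsB

/-!
# Crux `CovarianceBound` (stmt-QuantumFields-8780), ideator 4, round 2 — first-lemma signatures of the card
# `twist-stiffness-envelope` (winding envelope ⇒ zero mode ≤ L × relaxed unit-winding excess; cone inequality)

Vocabulary reused from the landed `…CovarianceBoundDefs/DefsB` (`coulombF`, `IsCoulMin`, `gluon`, `froSq`,
`wilson4`, `supLieCosSq`, `LatticeRep.lieAlgCarrier`). Tree convention: `gaugeTransform k U (x,i) = k x * U (x,i) * (k (x+eᵢ))⁻¹`.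

New objects (all explicit finite sums / infima of bounded families over nonempty index types — no junk values):
* `boostedCoulombF r S j U k B` — the slice Coulomb functional of `U^k` with the matrix `B` inserted to the RIGHT of
  `ρ(V_e)` on every time-zero link in spatial direction `j.succ` ("boost"). For `B = exp(L⁻¹ • X)`, `X ∈ 𝔤`,
  `exp X = 1`, it equals `coulombF r S U (w * k)` for the periodic WINDING `ρ(w x) = exp(-(x_{j+1}.val / L) • X)`.
* `twistedCoulombF r S j U h t` — twist `t ∈ G` inserted on the seam links (`x_{j+1} = 2S`) = Coulomb functional over
  quasi-periodic gauge transformations; `twistMin`, `perMin`, `twistGap := perMin − twistMin ≥ 0`.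
* `zeroModePair r S j U h X = ⟨Σ_y A_j(y), X⟩ = −Re tr((Σ_y A_j(y)) X)` — a `𝔤`-component of the ZERO MODE
  (`p = 0` cosine mode) of the gauge-fixed gluon field: the first derivative of the boosted functional.
* `relaxedWindingExcess r S j U h X` — `inf` over LOCAL deformations `k` of `h` (`ρ(k x) = exp(W x) ρ(h x)`,
  `W x ∈ 𝔤`, `‖W x‖²_F ≤ 1/4`) of the unit-winding energy, minus `F(h)`, minus the first-order term: the relaxed
  second-order cost of winding the minimal Coulomb gauge once around the `j`-cycle (= `½ L⁻² (K − H_loc)`,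
  `H_loc` the locally relaxed paramagnetic gain = Zwanziger's horizon-function component to quadratic order).
Statements (signatures only; proofs are M-sized bookkeeping + one Taylor estimate):
* `windingEnvelope_lower` / `zeroMode_abs_le` — DETERMINISTIC: at an absolute minimiser,
  `|⟨Σ_y A_j(y), X⟩| ≤ L · max(excess(X), excess(−X))` (absolute minimality against RELAXED windings, first-order term kept).
* `cone_inequality` — DETERMINISTIC: `⟨Σ_y A_j(y), X⟩² ≤ 2 (L³ ‖X‖²_F) · twistGap` (semiconcavity of the
  twist-energy class function at the trivial twist; tight on the disprover's spread toron).
* `RelaxedWindingExcessBound` — the TRANSFER (measure side): rms relaxed unit-winding excess `≤ √(D L)` at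
  `β ≥ β₀`, uniformly in the volume (droplet language: stiffness exponent `θ_s ≤ 1/2`).
* `LieModeBoundZero` — the record's minimal honest instance (`LieModeBound` at `p = 0`), the statement the two
  combine into (composition `lieModeBoundZero_of_excessBound`, via `CircleGeneratorsSpan`).
-/

set_option autoImplicit false

noncomputable section

namespace Summit.QuantumFields.YangMills.Cruxes.CovarianceBound.TwistStiffness

open scoped BigOperators Matrix ComplexConjugate
open MeasureTheory Literature.MathematicalPhysics.QuantumFieldTheory
open Summit.QuantumFields.YangMills.Cruxes.CovarianceBound.SupportWindow

variable {G : Type} [Group G] [TopologicalSpace G]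

/-- Boosted slice Coulomb functional: `-Σ_{e slice-spatial} Re tr(ρ((U^k)_e) · [B if e ∥ e_{j+1}])`. -/
def boostedCoulombF (r : LatticeRep G) (S : ℕ) (j : Fin 3) (U : GaugeConfig 4 (2 * S + 1) G)
    (k : Site 4 (2 * S + 1) → G) (B : Matrix (Fin r.N) (Fin r.N) ℂ) : ℝ :=
  -∑ e : Edge 4 (2 * S + 1),
    (if e.1 0 = 0 ∧ e.2 ≠ 0 then
      (r.ρ (gaugeTransform k U e) * (if e.2 = j.succ then B else 1)).trace.re else 0)

/-- Twisted slice Coulomb functional: the twist `t` is inserted on the seam links of direction `j.succ`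
(base site with `x_{j+1} = 2S`, i.e. the links wrapping from `2S` to `0`); ranging over `(h, t)` this is the
Coulomb functional over quasi-periodic gauge transformations `h(x + L e_{j+1}) ∼ h(x)·t`. -/
def twistedCoulombF (r : LatticeRep G) (S : ℕ) (j : Fin 3) (U : GaugeConfig 4 (2 * S + 1) G)
    (h : Site 4 (2 * S + 1) → G) (t : G) : ℝ :=
  -∑ e : Edge 4 (2 * S + 1),
    (if e.1 0 = 0 ∧ e.2 ≠ 0 then
      (r.ρ (gaugeTransform h U e *
        (if e.2 = j.succ ∧ (e.1 j.succ).val = 2 * S then t else 1))).trace.re else 0)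

/-- Periodic minimum of the slice Coulomb functional (attained: compactness; `coulombMinimisers_nonempty`). -/
def perMin (r : LatticeRep G) (S : ℕ) (U : GaugeConfig 4 (2 * S + 1) G) : ℝ :=
  ⨅ h : Site 4 (2 * S + 1) → G, coulombF r S U h

/-- Minimum over all twists and all gauge transformations (the best twisted boundary condition). -/
def twistMin (r : LatticeRep G) (S : ℕ) (j : Fin 3) (U : GaugeConfig 4 (2 * S + 1) G) : ℝ :=
  ⨅ th : G × (Site 4 (2 * S + 1) → G), twistedCoulombF r S j U th.2 th.1

/-- TWIST GAP: how much the minimal Coulomb energy drops when a twisted boundary condition in direction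
`j.succ` is allowed (`≥ 0`: `t = 1` is allowed). The defect energy of the "Coulomb gauge glass". -/
def twistGap (r : LatticeRep G) (S : ℕ) (j : Fin 3) (U : GaugeConfig 4 (2 * S + 1) G) : ℝ :=
  perMin r S U - twistMin r S j U

/-- Zero-mode pairing `⟨Σ_y A_j(y), X⟩_{Re tr(· ᴴ)} = -Re tr((Σ_y A_j(y)) X)` for skew-Hermitian `X`
(`A_j(y) = gluon r S U h y j`, the anti-Hermitian part of `ρ((U^h)_{(0,y),j+1})`): a `𝔤`-component of the
`p = 0` mode; equals `d/ds|₀ boostedCoulombF r S j U h (exp(s • X))`. -/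
def zeroModePair (r : LatticeRep G) (S : ℕ) (j : Fin 3) (U : GaugeConfig 4 (2 * S + 1) G)
    (h : Site 4 (2 * S + 1) → G) (X : Matrix (Fin r.N) (Fin r.N) ℂ) : ℝ :=
  -((∑ y : Fin 3 → ZMod (2 * S + 1), gluon r S U h y j) * X).trace.re

/-- `k` is a LOCAL deformation of `h`: `ρ(k x) = exp(W x) ρ(h x)` with `W x ∈ 𝔤`, `‖W x‖_F ≤ 1/2`. -/
def IsLocalDeformation (r : LatticeRep G) (S : ℕ) (h k : Site 4 (2 * S + 1) → G) : Prop :=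
  ∀ x, ∃ W ∈ r.lieAlgCarrier, froSq W ≤ 1 / 4 ∧ r.ρ (k x) = NormedSpace.exp W * r.ρ (h x)

/-- RELAXED UNIT-WINDING EXCESS: `inf_{k local deformation of h} F(U^{w k}) − F(U^h) − L⁻¹ ⟨Σ_y A_j(y), X⟩`,
where `w` is the unit winding generated by `X` (`exp X = 1`), written through the boost `B = exp(L⁻¹ • X)`.
Nonempty bounded infimum (take `k = h`). To quadratic order it is `½ L⁻² (K_X − H_X^{loc})` with
`K_X = -Σ_{j-links} Re tr(ρ(V) X²) ≤ L³ ‖X‖²_F` the bare boost stiffness and `H_X^{loc}` the locally relaxed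
paramagnetic (ghost) gain — minus Zwanziger's horizon-function component. -/
def relaxedWindingExcess (r : LatticeRep G) (S : ℕ) (j : Fin 3) (U : GaugeConfig 4 (2 * S + 1) G)
    (h : Site 4 (2 * S + 1) → G) (X : Matrix (Fin r.N) (Fin r.N) ℂ) : ℝ :=
  (⨅ k : {k : Site 4 (2 * S + 1) → G // IsLocalDeformation r S h k},
      boostedCoulombF r S j U k.1 (NormedSpace.exp (((2 * S + 1 : ℝ)⁻¹) • X)))
    - coulombF r S U h - (2 * S + 1 : ℝ)⁻¹ * zeroModePair r S j U h X

/-! ### Deterministic statements (first lemmas of the line) -/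

/-- **Winding envelope, lower form.** At an absolute Coulomb minimiser `h`, for a closed generator `X ∈ 𝔤`
(`exp X = 1`): `L⁻¹ ⟨Σ_y A_j(y), X⟩ ≥ − relaxedWindingExcess(X)`. Content: every boosted-by-`exp(L⁻¹X)` energy
of a deformation `k` is the periodic energy of the wound configuration `w·k`, hence `≥ F(h)` by minimality;
rearrange. -/
theorem windingEnvelope_lower (r : LatticeRep G) (S : ℕ) (j : Fin 3)
    (X : Matrix (Fin r.N) (Fin r.N) ℂ) (hX : X ∈ r.lieAlgCarrier) (hper : NormedSpace.exp X = 1)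
    (U : GaugeConfig 4 (2 * S + 1) G) (h : Site 4 (2 * S + 1) → G) (hmin : IsCoulMin r S U h) :
    -relaxedWindingExcess r S j U h X ≤ (2 * S + 1 : ℝ)⁻¹ * zeroModePair r S j U h X := by
  sorry

/-- **Zero mode ≤ L × relaxed unit-winding excess** (apply the lower form to `X` and `−X`). -/
theorem zeroMode_abs_le (r : LatticeRep G) (S : ℕ) (j : Fin 3)
    (X : Matrix (Fin r.N) (Fin r.N) ℂ) (hX : X ∈ r.lieAlgCarrier) (hper : NormedSpace.exp X = 1)
    (U : GaugeConfig 4 (2 * S + 1) G) (h : Site 4 (2 * S + 1) → G) (hmin : IsCoulMin r S U h) :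
    |zeroModePair r S j U h X| ≤
      (2 * S + 1 : ℝ) * max (relaxedWindingExcess r S j U h X) (relaxedWindingExcess r S j U h (-X)) := by
  sorry

/-- **Cone inequality.** At an absolute minimiser, `⟨Σ_y A_j(y), X⟩² ≤ 2 · (L³ ‖X‖²_F) · twistGap`: the twist-energy
class function `t ↦ twisted minimum` has a cone at `t = 1` of slope `|zero mode|/L`, and a semiconcave function that
must stay above `twistMin` cannot dip below `perMin − twistGap`. Tight on the spread toron of `Disproof.lean §A′`
(`twistGap ≈ π² L`, zero mode `≈ π L²`). No `exp X = 1` needed (arbitrary boosts are quasi-periodic). -/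
theorem cone_inequality (r : LatticeRep G) (S : ℕ) (j : Fin 3)
    (X : Matrix (Fin r.N) (Fin r.N) ℂ) (hX : X ∈ r.lieAlgCarrier)
    (U : GaugeConfig 4 (2 * S + 1) G) (h : Site 4 (2 * S + 1) → G) (hmin : IsCoulMin r S U h) :
    (zeroModePair r S j U h X) ^ 2 ≤ 2 * ((2 * S + 1 : ℝ) ^ 3 * froSq X) * twistGap r S j U := by
  sorry

/-! ### The transfer (measure side) and the instance of the crux it feeds -/

/-- **Relaxed winding excess bound** (route-posited, OPEN; the card's transfer `C⁺`): for every compact simple `G`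
and faithful unitary `r` there is `β₀` such that for `β ≥ β₀` there are `D > 0`, `S₀` with: on every torus
`(2S+1)⁴`, `S ≥ S₀`, for every spatial direction `j` and every closed generator `X ∈ 𝔤` (`exp X = 1`, size-capped),
`∫ sup_{h ∈ argmin} (relaxedWindingExcess r S j U h X)² dμ_β ≤ D · (2S+1)` — the locally relaxed second-order cost
of one winding of the minimal Coulomb gauge is `O(√L)` in `L²(μ)` (kinematically it is `O(L)`; on the spread toron
it IS `≍ L`). Droplet dictionary: excess `≍ L^{θ_s}`; the bound says `θ_s ≤ 1/2`. -/
def RelaxedWindingExcessBound : Prop :=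
  ∀ (G : Type) [Group G] [TopologicalSpace G] [IsTopologicalGroup G] [CompactSpace G]
    [MeasurableSpace G] [BorelSpace G], IsCompactSimpleLieGroup G → ∀ r : LatticeRep G,
    ∃ β₀ : ℝ, ∀ β : ℝ, β₀ ≤ β → ∃ D : ℝ, 0 < D ∧ ∃ S₀ : ℕ, ∀ S : ℕ, S₀ ≤ S →
      ∀ (j : Fin 3) (X : Matrix (Fin r.N) (Fin r.N) ℂ), X ∈ r.lieAlgCarrier →
        NormedSpace.exp X = 1 → froSq X ≤ 64 * Real.pi ^ 2 * r.N →
        ∫ U, (⨆ h : {h : Site 4 (2 * S + 1) → G // IsCoulMin r S U h},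
              (relaxedWindingExcess r S j U h.1 X) ^ 2) ∂(wilson4 r β S) ≤ D * (2 * S + 1 : ℝ)

/-- **Mean twist-gap bound** (route-posited, OPEN; the card's GLOBAL transfer `C⁺_glob`): the Wilson average of the
twist gap — the drop of the minimal slice Coulomb energy when the gauge transformation may be twisted around the `j`-cycle —
is bounded uniformly in the volume at `β ≥ β₀` ("the periodic sector of the Coulomb gauge glass is unfrustrated to O(1)";
stiffness exponent `θ_s ≤ 0` in b.c.-optimised defect-energy language). With `cone_inequality` it gives `LieModeBoundZero`
directly (`K ≤ L³‖X‖²_F` is kinematic). β = 0 toy (kit j019978/j019973): `E twistGap ≈ 3`, flat in `L = 5..11`. -/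
def MeanTwistGapBound : Prop :=
  ∀ (G : Type) [Group G] [TopologicalSpace G] [IsTopologicalGroup G] [CompactSpace G]
    [MeasurableSpace G] [BorelSpace G], IsCompactSimpleLieGroup G → ∀ r : LatticeRep G,
    ∃ β₀ : ℝ, ∀ β : ℝ, β₀ ≤ β → ∃ D : ℝ, 0 < D ∧ ∃ S₀ : ℕ, ∀ S : ℕ, S₀ ≤ S →
      ∀ j : Fin 3, ∫ U, twistGap r S j U ∂(wilson4 r β S) ≤ D

/-- `LieModeBound` at `p = 0` — the record's minimal honest instance of the crux (Lines/Sketch-dead.md):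
`∫ sup_h ‖P_𝔤 Σ_y A_j(y)‖²_F dμ_β ≤ D (2S+1)³`. -/
def LieModeBoundZero : Prop :=
  ∀ (G : Type) [Group G] [TopologicalSpace G] [IsTopologicalGroup G] [CompactSpace G]
    [MeasurableSpace G] [BorelSpace G], IsCompactSimpleLieGroup G → ∀ r : LatticeRep G,
    ∃ β₀ : ℝ, ∀ β : ℝ, β₀ ≤ β → ∃ D : ℝ, 0 < D ∧ ∃ S₀ : ℕ, ∀ S : ℕ, S₀ ≤ S →
      ∀ j : Fin 3, ∫ U, supLieCosSq r S 0 j U ∂(wilson4 r β S) ≤ D * (2 * S + 1 : ℝ) ^ 3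

/-- **Composition target of the line** (not proved here): closed generators span `𝔤` (landed predicate
`CircleGeneratorsSpan`, proved by the line `Sketch` as `stub_circleGeneratorsSpan`), so finitely many size-capped
`X` control `‖P_𝔤 Σ_y A_j(y)‖²_F ≤ C_r Σ_X ⟨Σ_y A_j(y), X⟩²`; then `zeroMode_abs_le` and the transfer give
`∫ sup ≤ C_r · L² · (D L) = (C_r D) L³`. -/
theorem lieModeBoundZero_of_excessBound
    (hspan : ∀ (G : Type) [Group G] [TopologicalSpace G] (r : LatticeRep G), CircleGeneratorsSpan r)
    (hC : RelaxedWindingExcessBound) : LieModeBoundZero := by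
  sorry

/-- **Composition target, global form** (not proved here): `cone_inequality` + `CircleGeneratorsSpan` +
`MeanTwistGapBound` ⇒ `LieModeBoundZero` with `D' = 2 C_r (max froSq X) D`. -/
theorem lieModeBoundZero_of_meanTwistGap
    (hspan : ∀ (G : Type) [Group G] [TopologicalSpace G] (r : LatticeRep G), CircleGeneratorsSpan r)
    (hT : MeanTwistGapBound) : LieModeBoundZero := by
  sorry

end Summit.QuantumFields.YangMills.Cruxes.CovarianceBound.TwistStiffness

end
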